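import Summits.CriticalPhenomena.PercolationContinuityZ3.Theorems.PercNearOneGluingNoHeavyLowerTailFourPointJoinTable
import Summits.CriticalPhenomena.PercolationContinuityZ3.Theorems.PercNearOneGluingNoHeavyLowerTailQ44SeparatorTools
import HarnessLib

/-!
# Conjecture W (row `Q44`, all `n`) across a TERMINAL-PAIR SEPARATOR, part 1: the terminals `{a,b}` separate `c` from `y`

Support file for crux `stmt-CriticalPhenomena-4575` (master-family programme; Conjecture W = row `Q44` = `TwoCopyMono.kerQ44`, open for all `n`),
seat `prim-l12-p6` gen 28; memo `run/shared/lean/prim/prim-l12/FROM-prim-l12-p6-g28-PORT-GLUING-LEAN.md` §0 (9) (THEOREM F).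

SETTING.  The weighting `w` on the pairs of `Fin n` is supported on two disjoint pair sets `D₁, D₂` whose pairs meet only in the two terminals of a
pair `{P, Q} ⊂ {a, b, c, y}`; the third terminal `R` lies on no pair of `D₂` and the fourth `S` on no pair of `D₁` (so `{P,Q}` separates `R` from
`S`).  By the join convolution (`FourPointPort.cell_eq_sum_join`) the four-point law of `w` is BILINEAR in the three-point law `p` of `(P,Q,R)` in the
piece `w₁ = w·1_{D₁}` and the three-point law `q` of `(P,Q,S)` in `w₂ = w·1_{D₂}`, and Conjecture W becomes a form of bidegree `(2,2)` in `(p,q)` which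
is an explicit nonnegative integer combination of products `SK3(p)·(monomial in q)`, `(monomial in p)·SK3(q)` and monomials (exact certificates, kit
j216311; `SK3` = Gladkov's three-point strong Harris–Kleitman inequality, `Literature.Probability.Percolation.prodBernoulli_threePoint_strongHarris`):
* `ConjWPort.q44_cells_of_sep_ab` — `{a,b}` separate `c` from `y`:
  `W = SK3(p)(2q₀q₂+q₀q₃+q₀q₄+q₁q₂) + SK3(q)(p₀p₂+2p₀p₃+p₀p₄+p₁p₃) + 2p₀p₃q₂q₃ + p₀p₄q₂q₃ + p₁p₃q₂q₃ + 2p₂p₃q₀q₂ + p₂p₃q₀q₄ + p₂p₃q₁q₂`;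
* `ConjWPort.q44_cells_of_sep_ac` — `{a,c}` separate `b` from `y`;  * `ConjWPort.q44_cells_of_sep_ay` — `{a,y}` separate `b` from `c`
(cells `p = (P|Q|R, PQ|R, PR|Q, P|QR, PQR)`, `q` likewise; the three remaining separators `{c,y}`, `{b,y}`, `{b,c}` are the images of these under the
Klein symmetry `{id, (ab)(cy), (ac)(by), (ay)(bc)}` of W).  With the auxiliary cell forms of `SK3` on the triples `{a,b,c}`, `{a,b,y}`, `{a,c,y}`
(`sk3_abc_cells`, `sk3_aby_cells`, `sk3_acy_cells`) and the vanishing of the cells joining an absent terminal (`cell_eq_zero_of_absent`).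
First W-theorems in which all four terminals may sit in arbitrarily large pieces (companions: THEOREM D, non-terminal cut vertex, memo §0 (7); THEOREM E,
`…Q44CutTerminal`).  No definitions, no named facts, no sorries, standard axioms.
[cite: Gladkov2024, Cor. 4.2]; [cite: Grimmett1999, §2.2 (independence of disjoint edge sets)]
-/

noncomputable section

namespace Summit.CriticalPhenomena.PercolationContinuityZ3.Theorems

namespace ConjWPort

open MeasureTheory Set Literature.Probability.LatticeModels Literature.Probability.Percolation
open FourPointAtoms FourPointPort
open Summit.CriticalPhenomena.PercolationContinuityZ3.Cruxes.AdditiveGluing.TieLine.ConnAtoms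
open scoped Classical

variable {n : ℕ}

/-! ### THEOREM F, separator `{a,b}` -/

/-- **Conjecture W when the terminals `{a,b}` separate `c` from `y`** (THEOREM F, class `sep_ab(c|y)`): `w = w₁ ⊔ w₂` on disjoint pair sets `D₁ ⊇ supp w₁`,
`D₂ ⊇ supp w₂` meeting only in `a, b`, with `y` on no pair of `D₁` and `c` on no pair of `D₂`; then `w` satisfies Conjecture W (literal cell
form).  Proof: the join convolution makes the cells of `w` bilinear in the laws of `(a,b,c)` in `w₁` and `(a,b,y)` in `w₂`, and the row is an
explicit nonnegative combination of `SK3 × monomial` products (kit j216311). [this work] -/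
theorem q44_cells_of_sep_ab {D₁ D₂ : Finset (Sym2 (Fin n))} {w w₁ w₂ : Sym2 (Fin n) → unitInterval} {a b c y : Fin n}
    (hD : Disjoint D₁ D₂) (hT : ∀ v : Fin n, ∀ e₁ ∈ D₁, ∀ e₂ ∈ D₂, v ∈ e₁ → v ∈ e₂ → v = a ∨ v = b)
    (hw0 : ∀ e, e ∉ D₁ → e ∉ D₂ → w e = 0) (hw₁ : ∀ e ∈ D₁, w e = w₁ e) (hw₁0 : ∀ e, e ∉ D₁ → w₁ e = 0)
    (hw₂ : ∀ e ∈ D₂, w e = w₂ e) (hw₂0 : ∀ e, e ∉ D₂ → w₂ e = 0)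
    (hy : ∀ e ∈ D₁, y ∉ e) (hc : ∀ e ∈ D₂, c ∉ e)
    (hya : y ≠ a) (hyb : y ≠ b) (hyc : y ≠ c) (hca : c ≠ a) (hcb : c ≠ b) :
    2 * (cell w a b c y 11 * cell w a b c y 9 + cell w a b c y 11 * cell w a b c y 8 + cell w a b c y 6 * cell w a b c y 8 +
        cell w a b c y 6 * cell w a b c y 1 + cell w a b c y 1 * cell w a b c y 8) +
        (cell w a b c y 2 * cell w a b c y 13 + cell w a b c y 1 * cell w a b c y 13 + cell w a b c y 5 * cell w a b c y 12 +
        cell w a b c y 1 * cell w a b c y 12 + cell w a b c y 6 * cell w a b c y 10 + cell w a b c y 6 * cell w a b c y 7 +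
          cell w a b c y 2 * cell w a b c y 10 + cell w a b c y 5 * cell w a b c y 7) ≤
      2 * ((cell w a b c y 11 + cell w a b c y 14) * cell w a b c y 0) := by
  have hT' : ∀ v : Fin n, ∀ e₁ ∈ D₁, ∀ e₂ ∈ D₂, v ∈ e₁ → v ∈ e₂ → v ∈ Set.range (quad a b c y) := fun v e₁ he₁ e₂ he₂ h1 h2 => by
    rcases hT v e₁ he₁ e₂ he₂ h1 h2 with h | h
    · exact ⟨0, h ▸ rfl⟩
    · exact ⟨1, h ▸ rfl⟩
  have star₁ : ∀ u, u ≠ y → (w₁ s(y, u) : ℝ) = 0 := fun u _ => by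
    have hz : w₁ s(y, u) = 0 := hw₁0 _ fun he => hy _ he (Sym2.mem_mk_left _ _)
    rw [hz]; rfl
  have star₂ : ∀ u, u ≠ c → (w₂ s(c, u) : ℝ) = 0 := fun u _ => by
    have hz : w₂ s(c, u) = 0 := hw₂0 _ fun he => hc _ he (Sym2.mem_mk_left _ _)
    rw [hz]; rfl
  have y1 : cell w₁ a b c y 1 = 0 := cell_eq_zero_of_absent w₁ a b c y 1 3 2 hyc (by decide) star₁
  have y2 : cell w₁ a b c y 2 = 0 := cell_eq_zero_of_absent w₁ a b c y 2 3 1 hyb (by decide) star₁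
  have y4 : cell w₁ a b c y 4 = 0 := cell_eq_zero_of_absent w₁ a b c y 4 3 0 hya (by decide) star₁
  have y7 : cell w₁ a b c y 7 = 0 := cell_eq_zero_of_absent w₁ a b c y 7 3 1 hyb (by decide) star₁
  have y8 : cell w₁ a b c y 8 = 0 := cell_eq_zero_of_absent w₁ a b c y 8 3 0 hya (by decide) star₁
  have y9 : cell w₁ a b c y 9 = 0 := cell_eq_zero_of_absent w₁ a b c y 9 3 1 hyb (by decide) star₁
  have y10 : cell w₁ a b c y 10 = 0 := cell_eq_zero_of_absent w₁ a b c y 10 3 0 hya (by decide) star₁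
  have y11 : cell w₁ a b c y 11 = 0 := cell_eq_zero_of_absent w₁ a b c y 11 3 2 hyc (by decide) star₁
  have y12 : cell w₁ a b c y 12 = 0 := cell_eq_zero_of_absent w₁ a b c y 12 3 0 hya (by decide) star₁
  have y14 : cell w₁ a b c y 14 = 0 := cell_eq_zero_of_absent w₁ a b c y 14 3 0 hya (by decide) star₁
  have x1 : cell w₂ a b c y 1 = 0 := cell_eq_zero_of_absent w₂ a b c y 1 2 3 hyc.symm (by decide) star₂
  have x3 : cell w₂ a b c y 3 = 0 := cell_eq_zero_of_absent w₂ a b c y 3 2 1 hcb (by decide) star₂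
  have x5 : cell w₂ a b c y 5 = 0 := cell_eq_zero_of_absent w₂ a b c y 5 2 0 hca (by decide) star₂
  have x7 : cell w₂ a b c y 7 = 0 := cell_eq_zero_of_absent w₂ a b c y 7 2 1 hcb (by decide) star₂
  have x8 : cell w₂ a b c y 8 = 0 := cell_eq_zero_of_absent w₂ a b c y 8 2 1 hcb (by decide) star₂
  have x9 : cell w₂ a b c y 9 = 0 := cell_eq_zero_of_absent w₂ a b c y 9 2 0 hca (by decide) star₂
  have x10 : cell w₂ a b c y 10 = 0 := cell_eq_zero_of_absent w₂ a b c y 10 2 0 hca (by decide) star₂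
  have x11 : cell w₂ a b c y 11 = 0 := cell_eq_zero_of_absent w₂ a b c y 11 2 3 hyc.symm (by decide) star₂
  have x13 : cell w₂ a b c y 13 = 0 := cell_eq_zero_of_absent w₂ a b c y 13 2 0 hca (by decide) star₂
  have x14 : cell w₂ a b c y 14 = 0 := cell_eq_zero_of_absent w₂ a b c y 14 2 0 hca (by decide) star₂
  have g0 : cell w a b c y 0 = cell w₁ a b c y 0 * cell w₂ a b c y 0 := by
    rw [cell_eq_sum_join hD hT' hw0 hw₁ hw₁0 hw₂ hw₂0 0, joinSum_eq_0]
    try ring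
  have g1 : cell w a b c y 1 = 0 := by
    rw [cell_eq_sum_join hD hT' hw0 hw₁ hw₁0 hw₂ hw₂0 1, joinSum_eq_1]
    rw [y1, x1]
    try ring
  have g2 : cell w a b c y 2 = cell w₁ a b c y 0 * cell w₂ a b c y 2 := by
    rw [cell_eq_sum_join hD hT' hw0 hw₁ hw₁0 hw₂ hw₂0 2, joinSum_eq_2]
    rw [y2]
    try ring
  have g3 : cell w a b c y 3 = cell w₁ a b c y 3 * cell w₂ a b c y 0 := by
    rw [cell_eq_sum_join hD hT' hw0 hw₁ hw₁0 hw₂ hw₂0 3, joinSum_eq_3]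
    rw [x3]
    try ring
  have g4 : cell w a b c y 4 = cell w₁ a b c y 0 * cell w₂ a b c y 4 := by
    rw [cell_eq_sum_join hD hT' hw0 hw₁ hw₁0 hw₂ hw₂0 4, joinSum_eq_4]
    rw [y4]
    try ring
  have g5 : cell w a b c y 5 = cell w₁ a b c y 5 * cell w₂ a b c y 0 := by
    rw [cell_eq_sum_join hD hT' hw0 hw₁ hw₁0 hw₂ hw₂0 5, joinSum_eq_5]
    rw [x5]
    try ring
  have g6 : cell w a b c y 6 = cell w₁ a b c y 0 * cell w₂ a b c y 6 + cell w₁ a b c y 6 * (cell w₂ a b c y 0 + cell w₂ a b c y 6) := by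
    rw [cell_eq_sum_join hD hT' hw0 hw₁ hw₁0 hw₂ hw₂0 6, joinSum_eq_6]
    try ring
  have g7 : cell w a b c y 7 = cell w₁ a b c y 3 * cell w₂ a b c y 2 := by
    rw [cell_eq_sum_join hD hT' hw0 hw₁ hw₁0 hw₂ hw₂0 7, joinSum_eq_7]
    rw [y1, y2, y7, x1, x3, x7]
    try ring
  have g8 : cell w a b c y 8 = cell w₁ a b c y 3 * cell w₂ a b c y 4 := by
    rw [cell_eq_sum_join hD hT' hw0 hw₁ hw₁0 hw₂ hw₂0 8, joinSum_eq_8]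
    rw [y4, y8, x3, x8]
    try ring
  have g9 : cell w a b c y 9 = cell w₁ a b c y 5 * cell w₂ a b c y 2 := by
    rw [cell_eq_sum_join hD hT' hw0 hw₁ hw₁0 hw₂ hw₂0 9, joinSum_eq_9]
    rw [y2, y9, x5, x9]
    try ring
  have g10 : cell w a b c y 10 = cell w₁ a b c y 5 * cell w₂ a b c y 4 := by
    rw [cell_eq_sum_join hD hT' hw0 hw₁ hw₁0 hw₂ hw₂0 10, joinSum_eq_10]
    rw [y1, y4, y10, x1, x5, x10]
    try ring
  have g11 : cell w a b c y 11 = 0 := by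
    rw [cell_eq_sum_join hD hT' hw0 hw₁ hw₁0 hw₂ hw₂0 11, joinSum_eq_11]
    rw [y1, y11, x1, x11]
    try ring
  have g12 : cell w a b c y 12 = cell w₁ a b c y 0 * cell w₂ a b c y 12 + cell w₁ a b c y 6 * (cell w₂ a b c y 2 + cell w₂ a b c y 4 +
        cell w₂ a b c y 12) := by
    rw [cell_eq_sum_join hD hT' hw0 hw₁ hw₁0 hw₂ hw₂0 12, joinSum_eq_12]
    rw [y2, y4, y12]
    try ring
  have g13 : cell w a b c y 13 = cell w₁ a b c y 3 * cell w₂ a b c y 6 + cell w₁ a b c y 5 * cell w₂ a b c y 6 +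
        cell w₁ a b c y 13 * (cell w₂ a b c y 0 + cell w₂ a b c y 6) := by
    rw [cell_eq_sum_join hD hT' hw0 hw₁ hw₁0 hw₂ hw₂0 13, joinSum_eq_13]
    rw [x3, x5, x13]
    try ring
  have g14 : cell w a b c y 14 = cell w₁ a b c y 3 * cell w₂ a b c y 12 + cell w₁ a b c y 5 * cell w₂ a b c y 12 +
        cell w₁ a b c y 13 * (cell w₂ a b c y 2 + cell w₂ a b c y 4 + cell w₂ a b c y 12) := by
    rw [cell_eq_sum_join hD hT' hw0 hw₁ hw₁0 hw₂ hw₂0 14, joinSum_eq_14]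
    rw [y1, y2, y4, y7, y8, y9, y10, y11, y12, y14, x1, x3, x5, x7, x8, x9, x10, x11, x13, x14]
    try ring
  have hs1 := sk3_abc_cells w₁ a b c y
  have hs2 := sk3_aby_cells w₂ a b c y
  rw [y1, y2, y4, y7, y8, y9, y10, y11, y12, y14] at hs1
  rw [x1, x3, x5, x7, x8, x9, x10, x11, x13, x14] at hs2
  have p0 := cell_nonneg w₁ a b c y 0
  have p3 := cell_nonneg w₁ a b c y 3
  have p5 := cell_nonneg w₁ a b c y 5
  have p6 := cell_nonneg w₁ a b c y 6
  have p13 := cell_nonneg w₁ a b c y 13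
  have q0 := cell_nonneg w₂ a b c y 0
  have q2 := cell_nonneg w₂ a b c y 2
  have q4 := cell_nonneg w₂ a b c y 4
  have q6 := cell_nonneg w₂ a b c y 6
  have q12 := cell_nonneg w₂ a b c y 12
  have t0 : 0 ≤ (cell w₁ a b c y 13 * cell w₁ a b c y 0 - cell w₁ a b c y 6 * cell w₁ a b c y 5 - cell w₁ a b c y 6 * cell w₁ a b c y 3 - cell w₁ a b c y 5 * cell w₁ a b c y 3) * (cell w₂ a b c y 0 * cell w₂ a b c y 4) := mul_nonneg (by linarith) (mul_nonneg q0 q4)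
  have t1 : 0 ≤ (cell w₁ a b c y 13 * cell w₁ a b c y 0 - cell w₁ a b c y 6 * cell w₁ a b c y 5 - cell w₁ a b c y 6 * cell w₁ a b c y 3 - cell w₁ a b c y 5 * cell w₁ a b c y 3) * (cell w₂ a b c y 0 * cell w₂ a b c y 2) := mul_nonneg (by linarith) (mul_nonneg q0 q2)
  have t2 : 0 ≤ (cell w₁ a b c y 13 * cell w₁ a b c y 0 - cell w₁ a b c y 6 * cell w₁ a b c y 5 - cell w₁ a b c y 6 * cell w₁ a b c y 3 - cell w₁ a b c y 5 * cell w₁ a b c y 3) * (cell w₂ a b c y 0 * cell w₂ a b c y 12) := mul_nonneg (by linarith) (mul_nonneg q0 q12)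
  have t3 : 0 ≤ (cell w₁ a b c y 13 * cell w₁ a b c y 0 - cell w₁ a b c y 6 * cell w₁ a b c y 5 - cell w₁ a b c y 6 * cell w₁ a b c y 3 - cell w₁ a b c y 5 * cell w₁ a b c y 3) * (cell w₂ a b c y 4 * cell w₂ a b c y 6) := mul_nonneg (by linarith) (mul_nonneg q4 q6)
  have t4 : 0 ≤ (cell w₁ a b c y 0 * cell w₁ a b c y 5) * (cell w₂ a b c y 12 * cell w₂ a b c y 0 - cell w₂ a b c y 6 * cell w₂ a b c y 4 - cell w₂ a b c y 6 * cell w₂ a b c y 2 - cell w₂ a b c y 4 * cell w₂ a b c y 2) := mul_nonneg (mul_nonneg p0 p5) (by linarith)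
  have t5 : 0 ≤ (cell w₁ a b c y 0 * cell w₁ a b c y 3) * (cell w₂ a b c y 12 * cell w₂ a b c y 0 - cell w₂ a b c y 6 * cell w₂ a b c y 4 - cell w₂ a b c y 6 * cell w₂ a b c y 2 - cell w₂ a b c y 4 * cell w₂ a b c y 2) := mul_nonneg (mul_nonneg p0 p3) (by linarith)
  have t6 : 0 ≤ (cell w₁ a b c y 0 * cell w₁ a b c y 3) * (cell w₂ a b c y 2 * cell w₂ a b c y 4) := mul_nonneg (mul_nonneg p0 p3) (mul_nonneg q2 q4)
  have t7 : 0 ≤ (cell w₁ a b c y 0 * cell w₁ a b c y 13) * (cell w₂ a b c y 12 * cell w₂ a b c y 0 - cell w₂ a b c y 6 * cell w₂ a b c y 4 - cell w₂ a b c y 6 * cell w₂ a b c y 2 - cell w₂ a b c y 4 * cell w₂ a b c y 2) := mul_nonneg (mul_nonneg p0 p13) (by linarith)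
  have t8 : 0 ≤ (cell w₁ a b c y 0 * cell w₁ a b c y 13) * (cell w₂ a b c y 2 * cell w₂ a b c y 4) := mul_nonneg (mul_nonneg p0 p13) (mul_nonneg q2 q4)
  have t9 : 0 ≤ (cell w₁ a b c y 3 * cell w₁ a b c y 6) * (cell w₂ a b c y 12 * cell w₂ a b c y 0 - cell w₂ a b c y 6 * cell w₂ a b c y 4 - cell w₂ a b c y 6 * cell w₂ a b c y 2 - cell w₂ a b c y 4 * cell w₂ a b c y 2) := mul_nonneg (mul_nonneg p3 p6) (by linarith)
  have t10 : 0 ≤ (cell w₁ a b c y 3 * cell w₁ a b c y 6) * (cell w₂ a b c y 2 * cell w₂ a b c y 4) := mul_nonneg (mul_nonneg p3 p6) (mul_nonneg q2 q4)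
  have t11 : 0 ≤ (cell w₁ a b c y 3 * cell w₁ a b c y 5) * (cell w₂ a b c y 0 * cell w₂ a b c y 4) := mul_nonneg (mul_nonneg p3 p5) (mul_nonneg q0 q4)
  have t12 : 0 ≤ (cell w₁ a b c y 3 * cell w₁ a b c y 5) * (cell w₂ a b c y 0 * cell w₂ a b c y 12) := mul_nonneg (mul_nonneg p3 p5) (mul_nonneg q0 q12)
  have t13 : 0 ≤ (cell w₁ a b c y 3 * cell w₁ a b c y 5) * (cell w₂ a b c y 4 * cell w₂ a b c y 6) := mul_nonneg (mul_nonneg p3 p5) (mul_nonneg q4 q6)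
  rw [g0, g1, g2, g5, g6, g7, g8, g9, g10, g11, g12, g13, g14]
  linarith [t0, t1, t2, t3, t4, t5, t6, t7, t8, t9, t10, t11, t12, t13]

end ConjWPort

end Summit.CriticalPhenomena.PercolationContinuityZ3.Theorems
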